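import Summits.AnomalousDissipation.AnomalousDissipation.Theorems.GalerkinInvariantLoud.Negative.Clauses

/-!
# Negative knowledge for the crux `MomentParity.GalerkinInvariantLoud` (stmt-AnomalousDissipation-14283), II:
# the radius clause is free — absorbing ball from polynomial stationarity

Certified copy of §3 of the cdisprove work file `Cruxes/GalerkinInvariantLoud/Disproof.lean`
(refuter-cdisprove-stmt-AnomalousDissipation-14283-0, cycle 1). Supports stmt-AnomalousDissipation-14283; no
conclusion asserts a Theses decl positively.

* `nsGeneratorPairing_energyPow_of_isLevel` — the row integrand of `(Σᵢ(u,gᵢ)²)^(n+1)` over the Galerkin frame on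
  level-`N` fields: `2(n+1)‖u‖^{2n}((u,f) − ν‖∇u‖²)`.
* `ae_norm_le_absorbing` — a finite law, level-`N` carried, supported in some ball and all-order stationary is carried
  by `‖u‖ ≤ ‖f‖₂/(4π²ν)` (monomial energy tests, Poincaré, `(b/a)^{2n} → 0`; no flow, no Weierstrass).
* `IsGILWitness.absorbing`, `not_galerkinInvariantLoud_iff`, `not_galerkinInvariantLoud_iff_absorbing` — a witness
  with any radius is one with the absorbing radius; a refutation need only kill `R_j = ‖f‖₂/(4π²ν_j)`.
-/

namespace Summit.AnomalousDissipation.AnomalousDissipation.Theorems.GalerkinInvariantLoud.Negative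

open MeasureTheory Filter Topology
open scoped ENNReal InnerProductSpace RealInnerProductSpace
open Literature.Analysis.FunctionSpaces Literature.Analysis.FluidPDE
open Summit.AnomalousDissipation.AnomalousDissipation.Theses.MomentParity
open Summit.AnomalousDissipation.AnomalousDissipation.Theorems
open Summit.AnomalousDissipation.AnomalousDissipation.Theorems.QuarticGate.Negative

noncomputable section

-- `T3`, `R3`, `H3`, `L2T3` (torus, values, energy space, `L²`), the level-`N` Galerkin frame `frameG N`
-- and the energy polynomial `energyPoly` are the sibling seat's (CubicParityLoud) abbreviations.
open Summit.AnomalousDissipation.AnomalousDissipation.Theorems.CubicParityLoud.Negative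
  (T3 R3 H3 L2T3 frameG energyPoly isBandTest_frameG eval_pderiv_energyPoly polyGrad_energy
   fourierTruncate_ae_eq_of_isLevel eGradNormSq_fourierTruncate_of_isLevel eGradNormSq_lt_top_of_isLevel
   inertialPairing_fourierTruncate_of_isLevel integral_inner_fourierTruncate_of_isLevel integrable_pairing)

/-! ## §3 NEW — the radius clause is FREE: compactly supported invariant level-`N` laws live in the
absorbing ball `‖u‖ ≤ ‖f‖₂/(4π²ν)` (FMRT IV (1.34) for genuine stationary statistical solutions; here
derived from POLYNOMIAL stationarity alone, via the rows of the powers `(Σᵢ(u,gᵢ)²)^(n+1)` of the energy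
observable over the Galerkin frame — no Weierstrass approximation, no flow). -/

section Absorbing

variable {ν : ℝ} {f : T3 → R3} {N : ℕ} {μ : Measure H3}

/-- `∂ᵢ (Σⱼ Xⱼ²)^(n+1) = (n+1) (Σⱼ Xⱼ²)^n · 2Xᵢ`, evaluated. -/
theorem eval_pderiv_energyPoly_pow {M : ℕ} (v : Fin M → ℝ) (i : Fin M) (n : ℕ) :
    MvPolynomial.eval v (MvPolynomial.pderiv i (energyPoly M ^ (n + 1))) =
      ((n : ℝ) + 1) * (∑ j, v j ^ 2) ^ n * (2 * v i) := by
  rw [Derivation.leibniz_pow, Nat.add_sub_cancel, map_nsmul, smul_eq_mul, map_mul, map_pow,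
    eval_pderiv_energyPoly, nsmul_eq_mul]
  have hE : MvPolynomial.eval v (energyPoly M) = ∑ j, v j ^ 2 := by
    simp [energyPoly, map_sum]
  rw [hE]
  push_cast
  ring

/-- The differential of the `(n+1)`-st power of the energy observable is `2(n+1) e(u)^n P_N u`,
`e(u) = Σⱼ (u,gⱼ)²`. -/
theorem polyGrad_energyPoly_pow (N : ℕ) (u : H3) (n : ℕ) :
    polyGrad (frameG N) (energyPoly _ ^ (n + 1)) u = fun x =>
      (((n : ℝ) + 1) * (∑ j, (Torus.pairing u.1 (frameG N j)) ^ 2) ^ n * 2) •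
        Torus.fourierTruncate N ((u : L2T3) : T3 → R3) x := by
  have h2 := polyGrad_energy N u
  funext x
  have h2x := congrFun h2 x
  simp only [polyGrad, CubicParityLoud.Negative.polyGrad, eval_pderiv_energyPoly] at h2x ⊢
  simp only [eval_pderiv_energyPoly_pow]
  have : ∀ i : Fin _, (((n : ℝ) + 1) * (∑ j, Torus.pairing u.1 (frameG N j) ^ 2) ^ n *
      (2 * Torus.pairing u.1 (frameG N i))) • frameG N i x =
      (((n : ℝ) + 1) * (∑ j, Torus.pairing u.1 (frameG N j) ^ 2) ^ n) •
        ((2 * Torus.pairing u.1 (frameG N i)) • frameG N i x) := fun i => by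
    rw [smul_smul]
  simp_rw [this, ← Finset.smul_sum, h2x, smul_smul]

/-- On level-`N` fields the frame energy is the energy: `Σⱼ (u,gⱼ)² = ‖u‖²`. -/
theorem sum_sq_pairing_frameG_of_isLevel {u : H3} (hu : IsLevel N u) :
    ∑ j, (Torus.pairing u.1 (frameG N j)) ^ 2 = ‖u‖ ^ 2 := by
  have h1 : ∑ j, (Torus.pairing u.1 (frameG N j)) ^ 2 =
      ∫ y, ‖Torus.fourierTruncate N ((u : L2T3) : T3 → R3) y‖ ^ 2 := by
    rw [← Torus.norm_sq_galerkinTest_coords N one_pos u, EuclideanSpace.real_norm_sq_eq]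
    rfl
  rw [h1, show ‖u‖ ^ 2 = ‖(u : L2T3)‖ ^ 2 from rfl, ← Torus.integral_norm_sq_coe_eq]
  refine integral_congr_ae ?_
  filter_upwards [fourierTruncate_ae_eq_of_isLevel hu] with x hx
  rw [hx]

/-- **The row integrand of `(Σ(u,gⱼ)²)^(n+1)` on level-`N` fields**:
`⟨F(u), ∇p(u)⟩ = 2(n+1)‖u‖^{2n} ((u,f) − ν‖∇u‖²)`. -/
theorem nsGeneratorPairing_energyPow_of_isLevel (ν : ℝ) (f : T3 → R3) {u : H3} (hu : IsLevel N u) (n : ℕ) :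
    Torus.nsGeneratorPairing ν f u (polyGrad (frameG N) (energyPoly _ ^ (n + 1)) u) =
      (((n : ℝ) + 1) * (‖u‖ ^ 2) ^ n * 2) *
        (Torus.pairing u.1 f - ν * (Torus.eGradNormSq ((u : L2T3) : T3 → R3)).toReal) := by
  rw [polyGrad_energyPoly_pow, Torus.nsGeneratorPairing_smul_fourierTruncate,
    sum_sq_pairing_frameG_of_isLevel hu, integral_inner_fourierTruncate_of_isLevel hu,
    eGradNormSq_fourierTruncate_of_isLevel hu, inertialPairing_fourierTruncate_of_isLevel hu, add_zero]

/-- `(‖∇u‖²).toReal ≤ 4π²N²‖u‖²` on level-`N` fields (Bernstein, real form). -/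
theorem toReal_eGradNormSq_le_of_isLevel {u : H3} (hu : IsLevel N u) :
    (Torus.eGradNormSq ((u : L2T3) : T3 → R3)).toReal ≤ 4 * Real.pi ^ 2 * (N : ℝ) ^ 2 * ‖u‖ ^ 2 := by
  have h := eGradNormSq_le_of_level (u : L2T3) hu
  have hfin : ENNReal.ofReal (4 * Real.pi ^ 2 * (N : ℝ) ^ 2) * ‖(u : L2T3)‖ₑ ^ 2 ≠ ⊤ :=
    ENNReal.mul_ne_top ENNReal.ofReal_ne_top (ENNReal.pow_ne_top enorm_ne_top)
  have h2 := ENNReal.toReal_mono hfin h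
  rw [ENNReal.toReal_mul, ENNReal.toReal_ofReal (by positivity), ← ofReal_norm,
    ← ENNReal.ofReal_pow (norm_nonneg _), ENNReal.toReal_ofReal (by positivity)] at h2
  exact h2

/-- **ABSORBING BALL from polynomial stationarity.** A finite law carried by level-`N` fields, supported in
SOME ball, whose rows of all powers of the frame energy observable vanish (in particular every all-order
stationary law of the crux), is carried by the absorbing ball `‖u‖ ≤ ‖f‖₂/(4π²ν)` (`0 < ν`).
Proof: the rows give `∫ ‖u‖^{2n} I dμ = 0`, `I = ν‖∇u‖² − (u,f) ≥ ‖u‖(4π²ν‖u‖ − ‖f‖₂)` (Poincaré);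
for `a > ρ` and `ρ < b < a`, `‖u‖^{2n} I ≥ a^{2n} c_a 𝟙_{‖u‖≥a} − b^{2n}|I|` pointwise, so
`μ(‖u‖ ≥ a) ≤ (b/a)^{2n} ∫|I|/c_a → 0`. Hence the clause `∃ R, ∀ᵐ ‖u‖ ≤ R` of the crux may always be
taken with `R = ‖f‖₂/(4π²ν_j)`: it carries no information beyond compactness of the support. -/
theorem ae_norm_le_absorbing (hν : 0 < ν) (hf : MemLp f 2 volume) [IsFiniteMeasure μ]
    (hlev : ∀ᵐ u ∂μ, IsLevel N u) {R : ℝ} (hR : ∀ᵐ u ∂μ, ‖u‖ ≤ R) (hinv : IsInvariant ν f N μ) :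
    ∀ᵐ u ∂μ, ‖u‖ ≤ ‖hf.toLp f‖ / (4 * Real.pi ^ 2 * ν) := by
  set F : ℝ := ‖hf.toLp f‖ with hF
  set ρ : ℝ := F / (4 * Real.pi ^ 2 * ν) with hρ
  have hF0 : 0 ≤ F := norm_nonneg _
  have hlam : 0 < 4 * Real.pi ^ 2 * ν := by positivity
  have hρ0 : 0 ≤ ρ := div_nonneg hF0 hlam.le
  -- the energy-balance integrand
  set D : H3 → ℝ := fun u => (Torus.eGradNormSq ((u : L2T3) : T3 → R3)).toReal with hD
  set I : H3 → ℝ := fun u => ν * D u - Torus.pairing u.1 f with hI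
  have h1 : Integrable (fun u : H3 => ‖u‖) μ := by simpa using integrable_norm_pow_of_ae_le hR 1
  -- (i) `I` is integrable (a.e. bounded and measurable)
  have hDmeas : AEStronglyMeasurable D μ :=
    (Torus.measurable_eGradNormSq_coe (d := Fin 3)).ennreal_toReal.aestronglyMeasurable
  have hDint : Integrable D μ := by
    refine Integrable.mono' ((integrable_norm_pow_of_ae_le hR 2).const_mul (4 * Real.pi ^ 2 * (N : ℝ) ^ 2))
      hDmeas ?_
    filter_upwards [hlev] with u hu
    rw [Real.norm_of_nonneg ENNReal.toReal_nonneg]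
    exact toReal_eGradNormSq_le_of_isLevel hu
  have hIint : Integrable I μ := (hDint.const_mul ν).sub (integrable_pairing hf h1)
  -- (ii) the rows of the powers of the energy observable
  have hrow : ∀ n : ℕ, ∫ u, ‖u‖ ^ (2 * n) * I u ∂μ = 0 := by
    intro n
    obtain ⟨-, hG0⟩ := hinv _ (frameG N) (energyPoly _ ^ (n + 1)) (fun i => isBandTest_frameG N i)
    have hae : (fun u => Torus.nsGeneratorPairing ν f u (polyGrad (frameG N) (energyPoly _ ^ (n + 1)) u))
        =ᵐ[μ] fun u => (-(2 * ((n : ℝ) + 1))) * (‖u‖ ^ (2 * n) * I u) :=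
      hlev.mono fun u hu => by
        show Torus.nsGeneratorPairing ν f u _ = _
        rw [nsGeneratorPairing_energyPow_of_isLevel ν f hu n]
        simp only [hI, hD, pow_mul]
        ring
    rw [integral_congr_ae hae, integral_const_mul] at hG0
    have hc : (-(2 * ((n : ℝ) + 1))) ≠ 0 := by
      have : (0 : ℝ) < 2 * ((n : ℝ) + 1) := by positivity
      linarith
    exact (mul_eq_zero.1 hG0).resolve_left hc
  -- (iii) Poincaré: `I u ≥ ‖u‖ (4π²ν‖u‖ − F)` a.e.
  have hlow : ∀ᵐ u ∂μ, ‖u‖ * (4 * Real.pi ^ 2 * ν * ‖u‖ - F) ≤ I u := by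
    filter_upwards [hlev] with u hu
    have hP := Torus.norm_sq_le_toReal_eGradNormSq u (eGradNormSq_lt_top_of_isLevel hu).ne
    have hp : Torus.pairing u.1 f ≤ ‖u‖ * F := (le_abs_self _).trans (Torus.abs_pairing_coe_le hf u)
    rw [hI, hD]
    dsimp only
    nlinarith [hν]
  -- (iv) every shell `{a ≤ ‖u‖}`, `a > ρ`, is null
  have hnull : ∀ a : ℝ, ρ < a → μ {u : H3 | a ≤ ‖u‖} = 0 := by
    intro a ha
    have ha0 : 0 < a := lt_of_le_of_lt hρ0 ha
    set b : ℝ := (ρ + a) / 2 with hb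
    have hρb : ρ < b := by rw [hb]; linarith
    have hba : b < a := by rw [hb]; linarith
    have hb0 : 0 < b := lt_of_le_of_lt hρ0 hρb
    have hgap : ∀ {t : ℝ}, ρ < t → 0 < 4 * Real.pi ^ 2 * ν * t - F := fun {t} ht => by
      rw [hρ, div_lt_iff₀ hlam] at ht
      linarith
    set c : ℝ := a * (4 * Real.pi ^ 2 * ν * a - F) with hc
    have hc0 : 0 < c := mul_pos ha0 (hgap ha)
    set S : Set H3 := {u | a ≤ ‖u‖} with hS
    have hSm : MeasurableSet S := measurableSet_le measurable_const continuous_norm.measurable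
    -- pointwise: `a^{2n} c 𝟙_S − b^{2n} |I| ≤ ‖u‖^{2n} I`
    have hpt : ∀ n : ℕ, ∀ᵐ u ∂μ,
        a ^ (2 * n) * c * S.indicator (fun _ => (1 : ℝ)) u - b ^ (2 * n) * |I u| ≤ ‖u‖ ^ (2 * n) * I u := by
      intro n
      filter_upwards [hlow] with u hu
      by_cases huS : u ∈ S
      · have hua : a ≤ ‖u‖ := huS
        rw [Set.indicator_of_mem huS, mul_one]
        have hIc : c ≤ I u := by
          have h1 : c ≤ ‖u‖ * (4 * Real.pi ^ 2 * ν * ‖u‖ - F) := by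
            rw [hc]
            apply mul_le_mul hua _ (hgap ha).le (norm_nonneg _)
            nlinarith
          exact h1.trans hu
        have hpow : a ^ (2 * n) ≤ ‖u‖ ^ (2 * n) := pow_le_pow_left₀ ha0.le hua _
        nlinarith [abs_nonneg (I u), mul_le_mul hpow hIc hc0.le (pow_nonneg (norm_nonneg u) _),
          pow_nonneg hb0.le (2 * n)]
      · rw [Set.indicator_of_notMem huS, mul_zero, zero_sub]
        by_cases hub : ‖u‖ ≤ b
        · have hpow : ‖u‖ ^ (2 * n) ≤ b ^ (2 * n) := pow_le_pow_left₀ (norm_nonneg _) hub _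
          nlinarith [neg_abs_le (I u), abs_nonneg (I u), pow_nonneg (norm_nonneg u) (2 * n),
            mul_le_mul_of_nonneg_right hpow (abs_nonneg (I u))]
        · rw [not_le] at hub
          have hI0 : 0 ≤ I u := by
            have : 0 ≤ ‖u‖ * (4 * Real.pi ^ 2 * ν * ‖u‖ - F) :=
              mul_nonneg (norm_nonneg _) (by nlinarith [hgap hρb])
            exact this.trans hu
          nlinarith [pow_nonneg (norm_nonneg u) (2 * n), abs_nonneg (I u), pow_nonneg hb0.le (2 * n),
            mul_nonneg (pow_nonneg (norm_nonneg u) (2 * n)) hI0]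
    -- integrate: `a^{2n} c μ(S) ≤ b^{2n} ∫ |I|`
    have hK : ∀ n : ℕ, a ^ (2 * n) * c * μ.real S ≤ b ^ (2 * n) * ∫ u, |I u| ∂μ := by
      intro n
      have hL : Integrable (fun u => a ^ (2 * n) * c * S.indicator (fun _ => (1 : ℝ)) u - b ^ (2 * n) * |I u|) μ :=
        (((integrable_const (1 : ℝ)).indicator hSm).const_mul _).sub (hIint.abs.const_mul _)
      have hRi : Integrable (fun u : H3 => ‖u‖ ^ (2 * n) * I u) μ := by
        obtain ⟨hGi, -⟩ := hinv _ (frameG N) (energyPoly _ ^ (n + 1)) (fun i => isBandTest_frameG N i)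
        have hae : (fun u : H3 => ‖u‖ ^ (2 * n) * I u) =ᵐ[μ] fun u =>
            (-(2 * ((n : ℝ) + 1)))⁻¹ *
              Torus.nsGeneratorPairing ν f u (polyGrad (frameG N) (energyPoly _ ^ (n + 1)) u) :=
          hlev.mono fun u hu => by
            show _ = (-(2 * ((n : ℝ) + 1)))⁻¹ * Torus.nsGeneratorPairing ν f u _
            rw [nsGeneratorPairing_energyPow_of_isLevel ν f hu n]
            simp only [hI, hD, pow_mul]
            have : (2 * ((n : ℝ) + 1)) ≠ 0 := by positivity
            field_simp
            ring
        exact (hGi.const_mul _).congr hae.symm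
      have hmono := integral_mono_ae hL hRi (hpt n)
      rw [hrow n, integral_sub (((integrable_const (1 : ℝ)).indicator hSm).const_mul _) (hIint.abs.const_mul _),
        integral_const_mul, integral_const_mul, integral_indicator_const (1 : ℝ) hSm, smul_eq_mul,
        mul_one] at hmono
      linarith
    -- let `n → ∞`
    have hq : b / a < 1 := (div_lt_one ha0).2 hba
    have hq0 : 0 ≤ b / a := div_nonneg hb0.le ha0.le
    have hlim : Tendsto (fun n : ℕ => (b / a) ^ (2 * n) * ((∫ u, |I u| ∂μ) / c)) atTop (𝓝 0) := by
      have h1 : Tendsto (fun n : ℕ => ((b / a) ^ 2) ^ n) atTop (𝓝 0) :=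
        tendsto_pow_atTop_nhds_zero_of_lt_one (by positivity) (by nlinarith)
      have h2 := h1.mul_const ((∫ u, |I u| ∂μ) / c)
      rw [zero_mul] at h2
      refine h2.congr fun n => ?_
      rw [← pow_mul]
    have hle : ∀ n : ℕ, μ.real S ≤ (b / a) ^ (2 * n) * ((∫ u, |I u| ∂μ) / c) := by
      intro n
      have h := hK n
      have hapos : 0 < a ^ (2 * n) := pow_pos ha0 _
      rw [div_pow, div_mul_div_comm, le_div_iff₀ (mul_pos hapos hc0)]
      nlinarith
    have hreal : μ.real S ≤ 0 := le_of_tendsto_of_tendsto' tendsto_const_nhds hlim hle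
    have hreal0 : μ.real S = 0 := le_antisymm hreal measureReal_nonneg
    exact (measureReal_eq_zero_iff (measure_ne_top μ S)).1 hreal0
  -- (v) exhaust `{ρ < ‖u‖}` by the shells `{ρ + 1/(n+1) ≤ ‖u‖}`
  have hsub : {u : H3 | ρ < ‖u‖} ⊆ ⋃ n : ℕ, {u | ρ + 1 / ((n : ℝ) + 1) ≤ ‖u‖} := by
    intro u hu
    simp only [Set.mem_setOf_eq] at hu
    obtain ⟨n, hn⟩ := exists_nat_one_div_lt (sub_pos.2 hu)
    exact Set.mem_iUnion.2 ⟨n, by simp only [Set.mem_setOf_eq]; linarith⟩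
  have hU : μ (⋃ n : ℕ, {u : H3 | ρ + 1 / ((n : ℝ) + 1) ≤ ‖u‖}) = 0 :=
    measure_iUnion_null fun n => hnull _ (by
      have : (0 : ℝ) < 1 / ((n : ℝ) + 1) := by positivity
      linarith)
  rw [ae_iff]
  refine measure_mono_null (fun u hu => hsub ?_) hU
  simpa only [Set.mem_setOf_eq, not_le] using hu

/-- **Radius normalisation for witnesses**: a witness with ANY support radius is a witness with the
absorbing radius `‖f‖₂/(4π²ν)`. So in `GalerkinInvariantLoud` the clause `∃ R` can be replaced by the
explicit `R_j = ‖f‖₂/(4π²ν_j)` without loss (and without gain). -/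
theorem IsGILWitness.absorbing {f : T3 → R3} (hf : MemLp f 2 volume) {ν : ℝ} (hν : 0 < ν) {N : ℕ}
    {R E ε : ℝ} {μ : Measure H3} (h : IsGILWitness f ν N R E ε μ) :
    IsGILWitness f ν N (‖hf.toLp f‖ / (4 * Real.pi ^ 2 * ν)) E ε μ := by
  obtain ⟨hp, hl, hR, hinv, hE, hε⟩ := h
  exact ⟨hp, hl, ae_norm_le_absorbing hν hf hl hR hinv, hinv, hE, hε⟩

end Absorbing

/-! ### §3b What a refutation must prove -/

section Shape

/-- **`¬ GalerkinInvariantLoud` unfolded**: a refutation is a UNIFORM-IN-`N` LAMINARISATION THEOREM for 3-D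
Galerkin NS — for every admissible force, every positive `ν_j → 0` and all budgets, SOME viscosity `ν_j` admits,
for every radius and all but finitely many levels, no loud bounded-energy compactly supported invariant law.
Open; believed false (converged DNS, Kaneda et al. 2003). Its 2-D analogue is TRUE (Alexakis–Doering `ε ≲ ν^{1/2}`
via the enstrophy Casimir = route item `PlanarCubicQuiet`); 3-D ball truncations have no definite quadratic
Casimir beyond `span{E, H}` (sibling kit jobs, ≤ 728 modes). -/
theorem not_galerkinInvariantLoud_iff :
    ¬ GalerkinInvariantLoud ↔ ∀ f : T3 → R3, Torus.IsSmooth f → Torus.IsDivFree f → Torus.HasZeroMean f →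
      ∀ (ν : ℕ → ℝ) (E ε : ℝ), (∀ j, 0 < ν j) → Tendsto ν atTop (𝓝 0) → 0 < ε →
      ∃ j : ℕ, ∀ R : ℝ, ∀ᶠ N in atTop, ∀ μ, ¬ IsGILWitness f (ν j) N R E ε μ := by
  rw [galerkinInvariantLoud_iff]
  simp only [not_exists, not_and, not_forall, Filter.not_frequently]

/-- **Only the absorbing radius matters** (§3): the crux fails iff it fails with `R_j = ‖f‖₂/(4π²ν_j)`. -/
theorem not_galerkinInvariantLoud_iff_absorbing :
    ¬ GalerkinInvariantLoud ↔ ∀ f : T3 → R3, Torus.IsSmooth f → Torus.IsDivFree f → Torus.HasZeroMean f →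
      ∀ (ν : ℕ → ℝ) (E ε : ℝ), (∀ j, 0 < ν j) → Tendsto ν atTop (𝓝 0) → 0 < ε →
      ∃ j : ℕ, ∀ᶠ N in atTop, ∀ μ,
        ¬ IsGILWitness f (ν j) N (Real.sqrt (∫ x, ‖f x‖ ^ 2) / (4 * Real.pi ^ 2 * ν j)) E ε μ := by
  rw [not_galerkinInvariantLoud_iff]
  refine forall_congr' fun f => forall_congr' fun hfs => forall_congr' fun hfd => forall_congr' fun hfz =>
    forall_congr' fun ν => forall_congr' fun E => forall_congr' fun ε => forall_congr' fun hν =>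
    forall_congr' fun hν0 => forall_congr' fun hε => exists_congr fun j => ⟨fun h => h _, fun h R => ?_⟩
  refine h.mono fun N hN μ hμ => hN μ ?_
  have := hμ.absorbing (hfs.memLp 2) (hν j)
  rwa [CubicParityLoud.Negative.norm_toLp_eq_sqrt] at this

end Shape

end

end Summit.AnomalousDissipation.AnomalousDissipation.Theorems.GalerkinInvariantLoud.Negative
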